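import Summits.BirchSwinnertonDyer.BirchSwinnertonDyer.Theorems.ByReductionTypeAtTwoGoodOrdTowerKernel
import Summits.BirchSwinnertonDyer.BirchSwinnertonDyer.Theorems.ByReductionTypeAtTwoGoodOrdTowerControlLayerFormalP
import Summits.BirchSwinnertonDyer.BirchSwinnertonDyer.Theorems.ByReductionTypeAtTwoGoodOrdTowerControlDevissage
import HarnessLib

/-!
# Route `ByReductionTypeAtTwo`, item `OrdKatoHalfAtTwo` (stmt-BirchSwinnertonDyer-19271), TOWER road: the local tower
# kernels `𝒦_{v,n}[p^∞]` at a good ORDINARY `v ∣ p` are FINITE and UNIFORMLY BOUNDED in the layer `n`, for EVERY prime `p`,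
# CONDITIONAL on Tate's local Euler–Poincaré characteristic formula for `ℚ_p` (named fact) — Greenberg's Lemma 3.4 at
# every layer in the form Mazur's control theorem needs (the unconditional `p = 2` case is `…ControlLayerBound.lean`)

HONEST FRAMING (cell `bsd-2adic`, run/shared/lean/pub/bsd-2adic/, seat `bsd-2adic-tower-1` GEN 20, HUMAN RULINGS
D-0036 / D-0054 / D-0074): TOOL theorem only (no definition, no named fact, no `sorry`); closes no item by itself;
nothing booked; BSD is not proved by any of this. WHAT IT DOES: Greenberg, LNM 1716 (1999), §3 Lemma 3.4 (p. 89: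
"`|ker(r_{v_n})| = |Ẽ(f_{v_n})_p|²`. It is finite and has bounded order as `n` varies") is a NAMED FACT in the tree
(`Greenberg1999.lemma34_natCard_localTowerKerPrimary_eq_rat`, hypothesis `h34` of 330 K4 tower displays, and the ONE
missing input of Mazur's control theorem over `ℚ`: `WeierstrassCurve.Greenberg1999_kerG_bounded_of_atP_layerBounds`,
`Literature/…/IwasawaSelmerControlOfLayerKernelsProofs.lean`). This file proves, at `p = 2`, the BOUNDEDNESS clause (which is
all the control theorem consumes): for `W/ℚ` globally minimal with good ordinary reduction at `2`, the cyclotomic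
`ℤ₂`-extension `κ` and `v ∣ 2`, there is `C` with `𝒦_{v,n}[2^∞]` finite of order `≤ C` for EVERY layer `n`. Chain
(Greenberg's diagram (5) with inequalities, GEN 11 bricks at depth `2^k`): BRICK 11 (`𝒦_{v,n}[2^∞][2^k] ↪ (M/(g−1)M)[2^k]`,
`M = E(K̄_v)^{H_∞}`), BRICK A′ (dévissage along the reduction: `#(M/(g−1)M)[2^k] ≤ #(M₁/(g−1)M₁)[2^k] · #red(M)`,
`M₁ = Ê(𝔪̄)^{H_∞}`, `red(M) ⊆ SF` finite by Hensel/Frobenius), the formal-group count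
`natCard_torsionBy_coinv_formal_le` (`#(M₁/(g−1)M₁)[2^k] ≤ #SF`, uniform in `n`, `k` — Kummer at depth `2^k`, Euler–Poincaré
by dévissage, local duality, Lutz), and `finite_and_natCard_le_of_forall_torsionBy_le` (a `2`-primary group with
uniformly bounded `2^k`-torsion is finite with the same bound).

* **`exists_natCard_localTowerKerPrimary_le_of_localEP`** — `localEulerPoincareCharacteristic ℚ_v → ∃ C, ∀ n, Finite 𝒦_{v,n}[p^∞] ∧ # ≤ C`
  (all `p`; the chain of `…ControlLayerBound.lean` with BRICK F / `natCard_torsionBy_coinv_formal_le_of_localEP` in place of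
  BRICKS C/C′).

References: R. Greenberg, LNM 1716 (1999), §2 Props. 2.2–2.5, §3 Lemmas 3.3–3.5 (pp. 86–90); B. Mazur, Invent. Math. 18
(1972), §6; J. Milne, *ADT* (2006), I §2–3; J.-P. Serre, *Galois Cohomology* (1997), I §2.5, II §5.
-/

set_option autoImplicit false
-- the Theorems namespace of this sub repeats the summit name by design (D-0017 nested layout: Summit.<S>.<Sub>)
set_option linter.dupNamespace false

noncomputable section

open scoped Classical NNReal

namespace Summit.BirchSwinnertonDyer.BirchSwinnertonDyer.Theorems.GoodOrdTower

open NumberField IsDedekindDomain Field Literature.NumberTheory.EllipticCurves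
  Literature.NumberTheory.GaloisRepresentations IsDedekindDomain.HeightOneSpectrum
  Literature.NumberTheory.EllipticCurves.FormalGroupChart Literature.NumberTheory.EllipticCurves.ResKernel
  Literature.NumberTheory.EllipticCurves.Rank1Residual WeierstrassCurve

set_option maxHeartbeats 3200000 in
/-- **The local tower kernels at a good ordinary `p` are finite and uniformly bounded in the layer, modulo Tate's local
Euler–Poincaré formula** (Greenberg's Lemma 3.4, boundedness clause, every `p`, conditional on the named fact
`localEulerPoincareCharacteristic ℚ_v`; unconditional at `p = 2` in `exists_natCard_localTowerKerPrimary_at_two_le`): for `W/ℚ` globally minimal with good ordinary reduction at `p`, the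
cyclotomic `ℤ_p`-extension `κ`, a place `v ∣ p`, there is `C : ℕ` such that for every layer `n` the `p`-power torsion
`𝒦_{v,n}[p^∞]` of the local tower kernel is finite with at most `C` elements (`C = #SF²`). This is exactly the `v ∣ p` input
of `WeierstrassCurve.Greenberg1999_kerG_bounded_of_atP_layerBounds`.
[cite: GreenbergLNM1716, §3 Lemma 3.4 (p. 89)] [cite: MilneADT2006, I Thm. 2.8, Cor. 2.3, Lemma 3.3] -/
theorem exists_natCard_localTowerKerPrimary_le_of_localEP {p : ℕ} [hp : Fact p.Prime] (W : WeierstrassCurve ℚ)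
    [W.IsGloballyMinimal] [W.IsElliptic]
    (hgo : GoodOrd W p) (κ : ZpExtension ℚ p) (hκ : κ.IsCyclotomic) (v : HeightOneSpectrum (𝓞 ℚ))
    (h2v : ((p : ℕ) : 𝓞 ℚ) ∈ v.asIdeal) (hEP : localEulerPoincareCharacteristic (v.adicCompletion ℚ)) :
    ∃ C : ℕ, ∀ n : ℕ, Finite (W.localTowerKerPrimary κ (v.adicCompletion ℚ) n) ∧
      Nat.card (W.localTowerKerPrimary κ (v.adicCompletion ℚ) n) ≤ C := by
  have hord : W.HasGoodReductionAtPrime p ∧ ¬ ((p : ℕ) : ℤ) ∣ W.frobeniusTrace p := hgo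
  have hΔ : ¬ ((p : ℕ) : ℤ) ∣ minimalDiscriminantInt W :=
    W.not_dvd_minimalDiscriminantInt_of_hasGoodReductionAtPrime' p hord.1
  have hap := hord.2
  -- the spectral valuation, the model, the reduction map (as in `SelmerCorankControlRatOrdinaryProofs` §1)
  obtain ⟨w, hw⟩ := v.exists_spectralValuation
  have hvO : w.Integers w.valuationSubring := Valuation.valuationSubring.integers w
  have hΔu := W.isUnit_Δ_localIntModel h2v hw hΔ
  let red₀ : localPoints W (v.adicCompletion ℚ) →+
      (((integralModelInt W).map (algebraMap ℤ ↥w.valuationSubring)).map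
        (IsLocalRing.residue ↥w.valuationSubring)).toAffine.Point :=
    (goodReductionHom _ hvO hΔu).comp
      (Affine.Point.congrEquiv (localIntModel_baseChange W w.valuationSubring).symm).toAddMonoidHom
  have hred₀ : ∀ P : localPoints W (v.adicCompletion ℚ), red₀ P =
      ((integralModelInt W).map (algebraMap ℤ ↥w.valuationSubring)).reducePoint
        (Affine.Point.congrEquiv (localIntModel_baseChange W w.valuationSubring).symm P) :=
    fun P ↦ rfl
  have hpO : w ((p : ℕ) : AlgebraicClosure (v.adicCompletion ℚ)) < 1 := by
    have h := spectralValuation_algebraMap_ringOfIntegers_lt_one (v := v) hw h2v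
    rwa [map_natCast] at h
  haveI hchar : CharP (IsLocalRing.ResidueField ↥w.valuationSubring) p := by
    refine (CharP.charP_iff_prime_eq_zero hp.out).mpr ?_
    rw [← map_natCast (IsLocalRing.residue ↥w.valuationSubring), IsLocalRing.residue_eq_zero_iff,
      IsLocalRing.mem_maximalIdeal, mem_nonunits_iff, hvO.isUnit_iff_valuation_eq_one, map_natCast]
    exact ne_of_lt hpO
  haveI hV : (W.baseChange (AlgebraicClosure (v.adicCompletion ℚ))).IsIntegral w.integer :=
    ⟨⟨(integralModelInt W).map (algebraMap ℤ ↥w.integer), W.baseChange_eq_localIntModel_integer_baseChange⟩⟩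
  -- the Frobenius inside `H_∞`
  obtain ⟨𝔐, h𝔐⟩ := v.localPrimesAbove_nonempty
  have hϖ : Irreducible ((p : ℕ) : v.adicCompletionIntegers ℚ) := irreducible_natCast_adicCompletionIntegers_rat h2v
  obtain ⟨τ, hτ, hτfix⟩ := exists_isArithFrobAt_forall_smul_eq hw h𝔐 h2v hϖ
  have hτHi : τ ∈ localSubgroup κ.kerSubgroup (v.adicCompletion ℚ) :=
    (mem_localSubgroup_iff _ _ τ).mpr (resGal_mem_kerSubgroup_of_forall_smul_rootOfUnity_eq hκ hτfix)
  -- the ordinary filtration, divisibility, the Frobenius-fixed reductions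
  have hordA := W.exists_zsmul_eq_zero_localRed_ne_zero hw hΔu red₀ hred₀ h2v hΔ hap
  obtain ⟨hgenr, hsurj, hdiv₁⟩ := W.localRed_ordinary_filtration hΔu red₀ hred₀ hordA
  obtain ⟨SF, hSF⟩ := W.exists_finset_localRed_smul_frobenius hw hΔu red₀ hred₀ h𝔐 hτ
  have hstab : ∀ (σ : absoluteGaloisGroup (v.adicCompletion ℚ)) (Q : localPoints W (v.adicCompletion ℚ)),
      red₀ Q = 0 → red₀ (σ • Q) = 0 :=
    fun σ Q hQ ↦ (W.localRed_smul_eq_zero_iff hw hΔu red₀ hred₀ σ Q).mpr hQ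
  have hkst : ∀ (σ : absoluteGaloisGroup (v.adicCompletion ℚ)) (a : (localPoints W (v.adicCompletion ℚ))), a ∈ red₀.ker → σ • a ∈ red₀.ker :=
    fun σ a ha ↦ (AddMonoidHom.mem_ker).mpr (hstab σ a ((AddMonoidHom.mem_ker).mp ha))
  have hker : ∀ Q : localPoints W (v.adicCompletion ℚ), red₀ Q = 0 ↔
      (Q : (W.baseChange (AlgebraicClosure (v.adicCompletion ℚ))).toAffine.Point) ∈
        kernel w (W.baseChange (AlgebraicClosure (v.adicCompletion ℚ))) := fun Q ↦
    W.localRed_eq_zero_iff_mem_kernel hΔu red₀ hred₀ Q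
  haveI hHiN : (localSubgroup κ.kerSubgroup (v.adicCompletion ℚ)).Normal := by
    rw [localSubgroup_eq_comap]; exact Subgroup.Normal.comap inferInstance _
  -- the constant
  refine ⟨SF.card * SF.card, fun n ↦ ?_⟩
  -- the layer: an inertial topological generator `g`, `M = E(K̄_v)^{H_∞}`, `M₁ = A₁^{H_∞}`, `D = g − 1`
  obtain ⟨g, hgI, hgn, hgen⟩ := exists_inertial_generator hκ v h2v n
  have hgred : ∀ Q : (localPoints W (v.adicCompletion ℚ)), red₀ (g • Q) = red₀ Q := fun Q ↦
    localRed_smul_eq_of_mem_absInertia W hw red₀ hred₀ h2v h𝔐 hgI Q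
  let M₁s : AddSubgroup (localPoints W (v.adicCompletion ℚ)) := red₀.ker ⊓ FixedPoints.addSubgroup (localSubgroup κ.kerSubgroup (v.adicCompletion ℚ)) (localPoints W (v.adicCompletion ℚ))
  have hM₁s : ∀ a, a ∈ M₁s ↔ a ∈ red₀.ker ∧ ∀ h ∈ (localSubgroup κ.kerSubgroup (v.adicCompletion ℚ)), h • a = a := fun a ↦ by
    change a ∈ red₀.ker ⊓ FixedPoints.addSubgroup (localSubgroup κ.kerSubgroup (v.adicCompletion ℚ)) (localPoints W (v.adicCompletion ℚ)) ↔ _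
    rw [AddSubgroup.mem_inf, FixedPoints.mem_addSubgroup]
    exact ⟨fun ⟨h1, h2⟩ ↦ ⟨h1, fun σ hσ ↦ h2 ⟨σ, hσ⟩⟩, fun ⟨h1, h2⟩ ↦ ⟨h1, fun σ ↦ h2 σ σ.2⟩⟩
  let D₁ : M₁s →+ M₁s :=
    { toFun := fun a ↦ ⟨g • (a : (localPoints W (v.adicCompletion ℚ))) - a, ⟨red₀.ker.sub_mem (hkst g a a.2.1) a.2.1,
        (subOne (localSubgroup κ.kerSubgroup (v.adicCompletion ℚ)) (localPoints W (v.adicCompletion ℚ)) g ⟨(a : (localPoints W (v.adicCompletion ℚ))), a.2.2⟩).2⟩⟩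
      map_zero' := Subtype.ext (by simp)
      map_add' := fun a b ↦ Subtype.ext (by
        simp only [AddSubgroup.coe_add, smul_add]
        abel) }
  have hD₁ : ∀ a : M₁s, ((D₁ a : M₁s) : (localPoints W (v.adicCompletion ℚ))) = g • (a : (localPoints W (v.adicCompletion ℚ))) - a := fun _ ↦ rfl
  -- integrality over the layer field (for Lutz at the layer)
  haveI := MultTowerNS2.finiteDimensional_fixedField_localSubgroup_layerSubgroup (κ := κ) v n
  haveI hVL : (W.baseChange (IntermediateField.fixedField (localSubgroup (κ.layerSubgroup n) (v.adicCompletion ℚ)) : IntermediateField (v.adicCompletion ℚ) (AlgebraicClosure (v.adicCompletion ℚ)))).IsIntegral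
      (w.comap (algebraMap (IntermediateField.fixedField (localSubgroup (κ.layerSubgroup n) (v.adicCompletion ℚ)) : IntermediateField (v.adicCompletion ℚ) (AlgebraicClosure (v.adicCompletion ℚ))) (AlgebraicClosure (v.adicCompletion ℚ)))).integer := by
    refine ⟨⟨(integralModelInt W).map (algebraMap ℤ _), ?_⟩⟩
    conv_lhs => rw [← map_integralModelInt W]
    rw [baseChange, baseChange, WeierstrassCurve.map_map, WeierstrassCurve.map_map]
    congr 1
    exact RingHom.ext_int _ _
  -- dévissage data (BRICK A′): `r = red₀` on `M`, Hensel lifts, `j : M₁ ↪ M`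
  have hrD : ∀ x : FixedPoints.addSubgroup (localSubgroup κ.kerSubgroup (v.adicCompletion ℚ)) (localPoints W (v.adicCompletion ℚ)),
      (red₀.comp (FixedPoints.addSubgroup (localSubgroup κ.kerSubgroup (v.adicCompletion ℚ)) (localPoints W (v.adicCompletion ℚ))).subtype) (subOne (localSubgroup κ.kerSubgroup (v.adicCompletion ℚ)) (localPoints W (v.adicCompletion ℚ)) g x) = 0 := fun x ↦ by
    rw [AddMonoidHom.comp_apply, AddSubgroup.coe_subtype, coe_subOne_apply, map_sub, hgred, sub_self]
  have hlift : ∀ x : FixedPoints.addSubgroup (localSubgroup κ.kerSubgroup (v.adicCompletion ℚ)) (localPoints W (v.adicCompletion ℚ)), ∃ x₀ : FixedPoints.addSubgroup (localSubgroup κ.kerSubgroup (v.adicCompletion ℚ)) (localPoints W (v.adicCompletion ℚ)),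
      subOne (localSubgroup κ.kerSubgroup (v.adicCompletion ℚ)) (localPoints W (v.adicCompletion ℚ)) g x₀ = 0 ∧ (red₀.comp (FixedPoints.addSubgroup (localSubgroup κ.kerSubgroup (v.adicCompletion ℚ)) (localPoints W (v.adicCompletion ℚ))).subtype) x₀ =
        (red₀.comp (FixedPoints.addSubgroup (localSubgroup κ.kerSubgroup (v.adicCompletion ℚ)) (localPoints W (v.adicCompletion ℚ))).subtype) x := fun x ↦ by
    have hτx : τ • (x : (localPoints W (v.adicCompletion ℚ))) = x := (FixedPoints.mem_addSubgroup _ _ _).mp x.2 ⟨τ, hτHi⟩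
    obtain ⟨P₀, hP₀fix, hP₀⟩ := exists_fixed_localRed_eq W hw hΔu red₀ hred₀ h2v hΔ h𝔐 hτ (x : (localPoints W (v.adicCompletion ℚ))) (by rw [hτx])
    refine ⟨⟨P₀, (FixedPoints.mem_addSubgroup _ _ _).mpr fun σ ↦ hP₀fix σ⟩, Subtype.ext ?_, ?_⟩
    · rw [coe_subOne_apply, hP₀fix, sub_self]; rfl
    · simpa using hP₀
  have hrj : ∀ y : FixedPoints.addSubgroup (localSubgroup κ.kerSubgroup (v.adicCompletion ℚ)) (localPoints W (v.adicCompletion ℚ)), (red₀.comp (FixedPoints.addSubgroup (localSubgroup κ.kerSubgroup (v.adicCompletion ℚ)) (localPoints W (v.adicCompletion ℚ))).subtype) y = 0 →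
      ∃ x : M₁s, AddSubgroup.inclusion (inf_le_right : M₁s ≤ FixedPoints.addSubgroup (localSubgroup κ.kerSubgroup (v.adicCompletion ℚ)) (localPoints W (v.adicCompletion ℚ))) x = y :=
    fun y hy ↦ ⟨⟨y, ⟨(AddMonoidHom.mem_ker).mpr hy, y.2⟩⟩, rfl⟩
  have hD₁j : ∀ x : M₁s, AddSubgroup.inclusion (inf_le_right : M₁s ≤ FixedPoints.addSubgroup (localSubgroup κ.kerSubgroup (v.adicCompletion ℚ)) (localPoints W (v.adicCompletion ℚ))) (D₁ x) =
      subOne (localSubgroup κ.kerSubgroup (v.adicCompletion ℚ)) (localPoints W (v.adicCompletion ℚ)) g (AddSubgroup.inclusion (inf_le_right : M₁s ≤ FixedPoints.addSubgroup (localSubgroup κ.kerSubgroup (v.adicCompletion ℚ)) (localPoints W (v.adicCompletion ℚ))) x) :=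
    fun x ↦ Subtype.ext rfl
  -- the image of `r` lies in `SF` (every point of `M` is fixed by `τ ∈ H_∞`)
  have hrange : ∀ y, y ∈ (red₀.comp (FixedPoints.addSubgroup (localSubgroup κ.kerSubgroup (v.adicCompletion ℚ))
      (localPoints W (v.adicCompletion ℚ))).subtype).range → y ∈ SF := by
    rintro _ ⟨x, rfl⟩
    rw [AddMonoidHom.comp_apply, AddSubgroup.coe_subtype]
    refine hSF _ ?_
    have hx : τ • (x : localPoints W (v.adicCompletion ℚ)) = x :=
      (FixedPoints.mem_addSubgroup _ _ _).mp x.2 ⟨τ, hτHi⟩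
    rw [hx]
  let ιr : (red₀.comp (FixedPoints.addSubgroup (localSubgroup κ.kerSubgroup (v.adicCompletion ℚ))
      (localPoints W (v.adicCompletion ℚ))).subtype).range → ↥SF := fun y ↦ ⟨y.1, hrange y.1 y.2⟩
  have hιr_val : ∀ y, ((ιr y : ↥SF) : _) = y.1 := fun _ ↦ rfl
  have hιr : Function.Injective ιr := fun a b hab ↦ by
    apply Subtype.ext
    rw [← hιr_val a, ← hιr_val b, hab]
  haveI hfinr : Finite (red₀.comp (FixedPoints.addSubgroup (localSubgroup κ.kerSubgroup (v.adicCompletion ℚ))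
      (localPoints W (v.adicCompletion ℚ))).subtype).range := Finite.of_injective ιr hιr
  have hcardr : Nat.card (red₀.comp (FixedPoints.addSubgroup (localSubgroup κ.kerSubgroup (v.adicCompletion ℚ))
      (localPoints W (v.adicCompletion ℚ))).subtype).range ≤ SF.card := by
    have h := Nat.card_le_card_of_injective ιr hιr
    rwa [Nat.card_eq_fintype_card (α := ↥SF), Fintype.card_coe] at h
  -- every depth `2^k`
  have hk : ∀ k : ℕ, Finite {x : W.localTowerKerPrimary κ (v.adicCompletion ℚ) n // p ^ k • x = 0} ∧
      Nat.card {x : W.localTowerKerPrimary κ (v.adicCompletion ℚ) n // p ^ k • x = 0} ≤ SF.card * SF.card := by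
    intro k
    -- the formal-group count: `#(M₁/D₁M₁)[2^k] ≤ #SF`
    obtain ⟨hfinT, hT⟩ := natCard_torsionBy_coinv_formal_le_of_localEP hκ v h2v hEP W n k hw red₀ hker hstab hdiv₁ hgenr hsurj
      hτHi hτfix SF hSF hgn hgen M₁s hM₁s D₁ hD₁
    haveI := hfinT
    -- BRICK A′
    obtain ⟨hfinM, hA⟩ := natCard_torsionBy_quotient_le_mul_card_range
      (subOne (localSubgroup κ.kerSubgroup (v.adicCompletion ℚ)) (localPoints W (v.adicCompletion ℚ)) g)
      (red₀.comp (FixedPoints.addSubgroup (localSubgroup κ.kerSubgroup (v.adicCompletion ℚ)) (localPoints W (v.adicCompletion ℚ))).subtype) hrD hlift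
      (AddSubgroup.inclusion (inf_le_right : M₁s ≤ FixedPoints.addSubgroup (localSubgroup κ.kerSubgroup (v.adicCompletion ℚ)) (localPoints W (v.adicCompletion ℚ))))
      (AddSubgroup.inclusion_injective _) hrj D₁ hD₁j (p ^ k)
    haveI := hfinM
    -- BRICK 11
    obtain ⟨hfinK, hK⟩ := MultTowerNS2.finite_torsionBy_localTowerKerPrimary_and_card_le W κ (v.adicCompletion ℚ) n hgn hgen (p ^ k)
    exact ⟨hfinK, hK.trans (hA.trans (Nat.mul_le_mul hT hcardr))⟩
  -- from the depths to the whole `2`-primary kernel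
  refine finite_and_natCard_le_of_forall_torsionBy_le p (fun x ↦ ?_) (fun k ↦ (hk k).1) (fun k ↦ (hk k).2)
  obtain ⟨k, hk'⟩ := ((W.mem_localTowerKerPrimary_iff κ (v.adicCompletion ℚ) n x.1).mp x.2).2
  exact ⟨k, Subtype.ext (by rw [AddSubmonoidClass.coe_nsmul, ZeroMemClass.coe_zero]; exact hk')⟩

end Summit.BirchSwinnertonDyer.BirchSwinnertonDyer.Theorems.GoodOrdTower

end
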